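import Literature.Computability.QuantumComplexity.InfluenceBounds
import Literature.Analysis.Approximation.MarkovInequality

/-!
# Crux `OneBlockDecoupling` (stmt-QuantumAdvantage-17873, route RandomOracleGauge), line `odonnell-zhao` — stub `stub_supBound`

O'Donnell–Zhao, *Polynomial bounds for decoupling, with applications*, arXiv:1512.01603, Cor. 2.12 (hypercube
case): the one-block-decoupled function of a `[0,1]`-bounded polynomial `p` of total degree `≤ d`,

  `dec p (y,z) = Σ_S p̂(S) Σ_{i∈S} sgn(y_i) Π_{j∈S∖i} sgn(z_j)`,

is bounded by `O(d²)` uniformly on the cube. O'Donnell–Zhao obtain this from their Lemma 4.1 (an explicit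
Vandermonde interpolation `f̃ = Σ_l c_l F(α_l y + β_l z)`, `‖c‖₁ = O(d²)`). Here we give a two-line proof from the
CLASSICAL MARKOV INEQUALITY (tree: `Literature.Analysis.Approximation.markov_inequality(_Icc)`), with the explicit
constant **`|dec p| ≤ 3d²`**. Let `F(t) = Σ_S p̂(S) Π_{j∈S} t_j` be the multilinear extension of `p` to the solid
cube `[−1,1]^N`; it takes values in `[0,1]` there (it is the average of `p` under the product measure with means
`t`, `mlext_mem_unitInterval`). For cube points `y, z` (read as `±1`-vectors `Y = sgn∘y`, `Z = sgn∘z`):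

* `g(α) := F(Z + α(Y − Z))` is a real polynomial of degree `≤ d` bounded by `1` on `[0,1]` (convex combinations
  of two vertices), and `g'(0) = Σ_S p̂(S) Σ_{i∈S} (Y_i − Z_i) Z_{S∖i} = dec p (y,z) − Σ_S |S| p̂(S) Z_S`;
  Markov on `[0,1]`: `|g'(0)| ≤ 2d²`;
* `k(ρ) := F(ρ Z) = Σ_S p̂(S) Z_S ρ^{|S|}` is a real polynomial of degree `≤ d` bounded by `1` on `[−1,1]`, and
  `k'(1) = Σ_S |S| p̂(S) Z_S`; Markov on `[−1,1]`: `|k'(1)| ≤ d²`.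

Hence `|dec p (y,z)| = |g'(0) + k'(1)| ≤ 3d²`: **`stub_supBound`** (registered signature, BY NAME, with
`(κ, K) = (2, 3)`). No new definitions; the only named facts are PROVED tree theorems (Markov's inequality,
Korneichuk Thm. 3.5.8, `MarkovInequality.lean`).
-/

-- D-0017: single-conjunct summit ⇒ the duplicate `QuantumAdvantage.QuantumAdvantage` is mandated.
set_option linter.dupNamespace false

noncomputable section

open Finset Polynomial
open Literature.Computability.QuantumComplexity
open Literature.Probability.RandomGraphs.LowDegree (sgn walsh)
open Literature.Computability.Complexity.LowDegree (cubeFourierCoeff)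

namespace Summit.QuantumAdvantage.QuantumAdvantage.Cruxes.OneBlockDecoupling.OdonnellZhao

namespace StubSupBound

variable {N : ℕ}

/-! ### The multilinear extension takes values in `[0,1]` on the solid cube -/

/-- Product-measure average of a character: with weights `w_t(x) = Π_i (1 + sgn(x_i) t_i)/2`,
`Σ_x w_t(x) χ_S(x) = Π_{j∈S} t_j`. [cite: ODonnell2014, §1.4] -/
theorem sum_weight_mul_walsh (t : Fin N → ℝ) (S : Finset (Fin N)) :
    ∑ x : Fin N → Bool, (∏ i, (1 + sgn (x i) * t i) / 2) * walsh S x = ∏ j ∈ S, t j := by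
  classical
  have key : ∀ x : Fin N → Bool, (∏ i, (1 + sgn (x i) * t i) / 2) * walsh S x =
      ∏ i, ((1 + sgn (x i) * t i) / 2 * (if i ∈ S then sgn (x i) else 1)) := by
    intro x
    rw [Literature.Computability.Complexity.LowDegree.walsh_eq_prod_ite, ← Finset.prod_mul_distrib]
  simp_rw [key]
  have h := Finset.prod_univ_sum (fun _ : Fin N => (Finset.univ : Finset Bool))
    (fun i b => (1 + sgn b * t i) / 2 * (if i ∈ S then sgn b else (1 : ℝ)))
  rw [Fintype.piFinset_univ] at h
  rw [← h]
  have hi : ∀ i : Fin N, ∑ b : Bool, (1 + sgn b * t i) / 2 * (if i ∈ S then sgn b else (1 : ℝ)) =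
      if i ∈ S then t i else 1 := by
    intro i
    rw [Fintype.sum_bool]
    by_cases hiS : i ∈ S
    · simp [hiS, sgn]; ring
    · simp [hiS, sgn]; ring
  simp_rw [hi]
  rw [Finset.prod_ite_mem, Finset.univ_inter]

/-- The multilinear extension `F(t) = Σ_S p̂(S) Π_{j∈S} t_j` is the `w_t`-average of `p` over the cube.
[cite: ODonnellZhao2016, §2 (multilinear extension)] -/
theorem mlext_eq_weighted_sum (p : MvPolynomial (Fin N) ℝ) (t : Fin N → ℝ) :
    ∑ S : Finset (Fin N), cubeFourierCoeff (evalBool p) S * ∏ j ∈ S, t j =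
      ∑ x : Fin N → Bool, (∏ i, (1 + sgn (x i) * t i) / 2) * evalBool p x := by
  simp_rw [← sum_weight_mul_walsh t, Finset.mul_sum]
  rw [Finset.sum_comm]
  refine Finset.sum_congr rfl fun x _ => ?_
  rw [← Literature.Computability.Complexity.LowDegree.sum_cubeFourierCoeff_mul_walsh (evalBool p) x,
    Finset.mul_sum]
  exact Finset.sum_congr rfl fun S _ => by ring

/-- **Interpolation bound**: for `t ∈ [−1,1]^N` and `0 ≤ p ≤ 1` on the cube, `0 ≤ F(t) ≤ 1`. [cite: ODonnellZhao2016, §2] -/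
theorem mlext_mem_unitInterval {p : MvPolynomial (Fin N) ℝ}
    (hb : ∀ x, 0 ≤ evalBool p x ∧ evalBool p x ≤ 1) {t : Fin N → ℝ} (ht : ∀ i, |t i| ≤ 1) :
    0 ≤ ∑ S : Finset (Fin N), cubeFourierCoeff (evalBool p) S * ∏ j ∈ S, t j ∧
      ∑ S : Finset (Fin N), cubeFourierCoeff (evalBool p) S * ∏ j ∈ S, t j ≤ 1 := by
  rw [mlext_eq_weighted_sum]
  have hw : ∀ x : Fin N → Bool, 0 ≤ ∏ i, (1 + sgn (x i) * t i) / 2 := by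
    intro x
    refine Finset.prod_nonneg fun i _ => ?_
    have h1 := abs_le.mp (ht i)
    cases x i <;> simp [sgn] <;> linarith
  have hsum : ∑ x : Fin N → Bool, (∏ i, (1 + sgn (x i) * t i) / 2) = 1 := by
    have h := sum_weight_mul_walsh t ∅
    simpa [walsh] using h
  constructor
  · exact Finset.sum_nonneg fun x _ => mul_nonneg (hw x) (hb x).1
  · calc ∑ x : Fin N → Bool, (∏ i, (1 + sgn (x i) * t i) / 2) * evalBool p x
        ≤ ∑ x : Fin N → Bool, (∏ i, (1 + sgn (x i) * t i) / 2) := by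
          refine Finset.sum_le_sum fun x _ => ?_
          have := mul_le_mul_of_nonneg_left (hb x).2 (hw x)
          simpa using this
      _ = 1 := hsum

/-- `|F(t)| ≤ 1` on the solid cube. [cite: ODonnellZhao2016, §2] -/
theorem abs_mlext_le_one {p : MvPolynomial (Fin N) ℝ}
    (hb : ∀ x, 0 ≤ evalBool p x ∧ evalBool p x ≤ 1) {t : Fin N → ℝ} (ht : ∀ i, |t i| ≤ 1) :
    |∑ S : Finset (Fin N), cubeFourierCoeff (evalBool p) S * ∏ j ∈ S, t j| ≤ 1 := by
  obtain ⟨h0, h1⟩ := mlext_mem_unitInterval hb ht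
  rw [abs_le]; constructor <;> linarith

/-! ### The directional polynomial `g(α) = F(Z + α(Y − Z))` -/

/-- Evaluation of the directional polynomial. [folklore] -/
theorem eval_dirPoly (a : Finset (Fin N) → ℝ) (Y Z : Fin N → ℝ) (α : ℝ) :
    (∑ S : Finset (Fin N), C (a S) * ∏ j ∈ S, (C (Y j - Z j) * X + C (Z j))).eval α =
      ∑ S : Finset (Fin N), a S * ∏ j ∈ S, (Z j + α * (Y j - Z j)) := by
  rw [Polynomial.eval_finsetSum]
  refine Finset.sum_congr rfl fun S _ => ?_
  rw [Polynomial.eval_mul, Polynomial.eval_C, Polynomial.eval_prod]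
  congr 1
  exact Finset.prod_congr rfl fun j _ => by simp; ring

/-- Degree of the directional polynomial: `≤ d` if the coefficients vanish above level `d`. [folklore] -/
theorem natDegree_dirPoly_le {a : Finset (Fin N) → ℝ} {d : ℕ} (ha : ∀ S : Finset (Fin N), d < S.card → a S = 0)
    (Y Z : Fin N → ℝ) :
    (∑ S : Finset (Fin N), C (a S) * ∏ j ∈ S, (C (Y j - Z j) * X + C (Z j))).natDegree ≤ d := by
  refine Polynomial.natDegree_sum_le_of_forall_le _ _ fun S _ => ?_
  by_cases hS : d < S.card
  · rw [ha S hS, map_zero, zero_mul, Polynomial.natDegree_zero]; exact Nat.zero_le _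
  · push Not at hS
    refine (Polynomial.natDegree_C_mul_le _ _).trans ((Polynomial.natDegree_prod_le _ _).trans ?_)
    refine (Finset.sum_le_sum fun j _ => Polynomial.natDegree_linear_le).trans ?_
    simpa using hS

/-- Derivative of the directional polynomial at `0`:
`g'(0) = Σ_S a_S Σ_{i∈S} (Y_i − Z_i) Π_{j∈S∖i} Z_j`. [folklore] -/
theorem eval_zero_derivative_dirPoly (a : Finset (Fin N) → ℝ) (Y Z : Fin N → ℝ) :
    (derivative (∑ S : Finset (Fin N), C (a S) * ∏ j ∈ S, (C (Y j - Z j) * X + C (Z j)))).eval 0 =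
      ∑ S : Finset (Fin N), a S * ∑ i ∈ S, (Y i - Z i) * ∏ j ∈ S.erase i, Z j := by
  classical
  rw [Polynomial.derivative_sum, Polynomial.eval_finsetSum]
  refine Finset.sum_congr rfl fun S _ => ?_
  rw [Polynomial.derivative_C_mul, Polynomial.eval_mul, Polynomial.eval_C, Polynomial.derivative_prod_finset,
    Polynomial.eval_finsetSum]
  congr 1
  refine Finset.sum_congr rfl fun i _ => ?_
  rw [Polynomial.eval_mul, Polynomial.eval_prod]
  have hd : (derivative (C (Y i - Z i) * X + C (Z i))).eval 0 = Y i - Z i := by simp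
  rw [hd, mul_comm]
  congr 1
  exact Finset.prod_congr rfl fun j _ => by simp

/-! ### The radial polynomial `k(ρ) = F(ρZ)` -/

/-- Evaluation of the radial polynomial. [folklore] -/
theorem eval_radPoly (a : Finset (Fin N) → ℝ) (Z : Fin N → ℝ) (ρ : ℝ) :
    (∑ S : Finset (Fin N), C (a S * ∏ j ∈ S, Z j) * X ^ S.card).eval ρ =
      ∑ S : Finset (Fin N), a S * ∏ j ∈ S, (ρ * Z j) := by
  rw [Polynomial.eval_finsetSum]
  refine Finset.sum_congr rfl fun S _ => ?_
  rw [Polynomial.eval_mul, Polynomial.eval_C, Polynomial.eval_pow, Polynomial.eval_X, Finset.prod_mul_distrib,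
    Finset.prod_const]
  ring

/-- Degree of the radial polynomial. [folklore] -/
theorem natDegree_radPoly_le {a : Finset (Fin N) → ℝ} {d : ℕ} (ha : ∀ S : Finset (Fin N), d < S.card → a S = 0)
    (Z : Fin N → ℝ) :
    (∑ S : Finset (Fin N), C (a S * ∏ j ∈ S, Z j) * X ^ S.card).natDegree ≤ d := by
  refine Polynomial.natDegree_sum_le_of_forall_le _ _ fun S _ => ?_
  by_cases hS : d < S.card
  · rw [ha S hS, zero_mul, map_zero, zero_mul, Polynomial.natDegree_zero]; exact Nat.zero_le _
  · push Not at hS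
    exact (Polynomial.natDegree_C_mul_X_pow_le _ _).trans hS

/-- Derivative of the radial polynomial at `1`: `k'(1) = Σ_S |S| a_S Z_S`. [folklore] -/
theorem eval_one_derivative_radPoly (a : Finset (Fin N) → ℝ) (Z : Fin N → ℝ) :
    (derivative (∑ S : Finset (Fin N), C (a S * ∏ j ∈ S, Z j) * X ^ S.card)).eval 1 =
      ∑ S : Finset (Fin N), (S.card : ℝ) * (a S * ∏ j ∈ S, Z j) := by
  rw [Polynomial.derivative_sum, Polynomial.eval_finsetSum]
  refine Finset.sum_congr rfl fun S _ => ?_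
  rw [Polynomial.derivative_C_mul_X_pow, Polynomial.eval_mul, Polynomial.eval_C, Polynomial.eval_pow,
    Polynomial.eval_X, one_pow, mul_one]
  ring

/-! ### The algebraic identity `dec = g'(0) + k'(1)` -/

/-- `Σ_S a_S Σ_{i∈S} Y_i Z_{S∖i} = g'(0) + Σ_S |S| a_S Z_S`. [folklore] -/
theorem dec_eq_dir_add_rad (a : Finset (Fin N) → ℝ) (Y Z : Fin N → ℝ) :
    ∑ S : Finset (Fin N), a S * ∑ i ∈ S, Y i * ∏ j ∈ S.erase i, Z j =
      (∑ S : Finset (Fin N), a S * ∑ i ∈ S, (Y i - Z i) * ∏ j ∈ S.erase i, Z j) +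
        ∑ S : Finset (Fin N), (S.card : ℝ) * (a S * ∏ j ∈ S, Z j) := by
  classical
  rw [← Finset.sum_add_distrib]
  refine Finset.sum_congr rfl fun S _ => ?_
  have h : ∑ i ∈ S, Z i * ∏ j ∈ S.erase i, Z j = (S.card : ℝ) * ∏ j ∈ S, Z j := by
    have : ∀ i ∈ S, Z i * ∏ j ∈ S.erase i, Z j = ∏ j ∈ S, Z j := by
      intro i hi; rw [mul_comm, Finset.prod_erase_mul _ _ hi]
    rw [Finset.sum_congr rfl this, Finset.sum_const, nsmul_eq_mul]
  have h2 : ∑ i ∈ S, (Y i - Z i) * ∏ j ∈ S.erase i, Z j =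
      ∑ i ∈ S, Y i * ∏ j ∈ S.erase i, Z j - ∑ i ∈ S, Z i * ∏ j ∈ S.erase i, Z j := by
    rw [← Finset.sum_sub_distrib]
    exact Finset.sum_congr rfl fun i _ => by ring
  rw [h2, h]
  ring

/-! ### The bound `|dec p| ≤ 3d²` -/

/-- **O'Donnell–Zhao's sup bound, via Markov's inequality**: for `0 ≤ p ≤ 1` on the cube with
`p.totalDegree ≤ d`, `|dec p (y,z)| ≤ 3d²` for all cube points `y, z`. [cite: ODonnellZhao2016, Cor. 2.12]
[cite: Korneichuk1991, Thm. 3.5.8] -/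
theorem abs_dec_le {p : MvPolynomial (Fin N) ℝ} {d : ℕ} (hp : p.totalDegree ≤ d)
    (hb : ∀ x, 0 ≤ evalBool p x ∧ evalBool p x ≤ 1) (y z : Fin N → Bool) :
    |∑ S : Finset (Fin N), cubeFourierCoeff (evalBool p) S *
        ∑ i ∈ S, sgn (y i) * ∏ j ∈ S.erase i, sgn (z j)| ≤ 3 * (d : ℝ) ^ 2 := by
  classical
  set a : Finset (Fin N) → ℝ := cubeFourierCoeff (evalBool p) with ha_def
  set Y : Fin N → ℝ := fun i => sgn (y i) with hY
  set Z : Fin N → ℝ := fun i => sgn (z i) with hZ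
  have ha : ∀ S : Finset (Fin N), d < S.card → a S = 0 := fun S hS => cubeFourierCoeff_evalBool_eq_zero hp hS
  have hsgn : ∀ b : Bool, |sgn b| ≤ 1 := by intro b; cases b <;> simp [sgn]
  have hsgn' : ∀ b : Bool, sgn b = 1 ∨ sgn b = -1 := by intro b; cases b <;> simp [sgn]
  -- the directional polynomial and Markov on `[0,1]`
  set g : ℝ[X] := ∑ S : Finset (Fin N), C (a S) * ∏ j ∈ S, (C (Y j - Z j) * X + C (Z j)) with hg
  have hgdeg : g.degree ≤ d := Polynomial.degree_le_of_natDegree_le (natDegree_dirPoly_le ha Y Z)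
  have hgM : ∀ α ∈ Set.Icc (0 : ℝ) 1, |g.eval α| ≤ 1 := by
    intro α hα
    rw [hg, eval_dirPoly]
    refine abs_mlext_le_one hb fun i => ?_
    -- `Z_i + α (Y_i − Z_i)` is a convex combination of two signs
    rcases hsgn' (y i) with h1 | h1 <;> rcases hsgn' (z i) with h2 | h2 <;>
      · simp only [hY, hZ, h1, h2]; rw [abs_le]; constructor <;> nlinarith [hα.1, hα.2]
  have hg' : |(derivative g).eval 0| ≤ 2 * (d : ℝ) ^ 2 := by
    have h := Literature.Analysis.Approximation.markov_inequality_Icc hgdeg zero_lt_one hgM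
      (x := 0) ⟨le_refl _, zero_le_one⟩
    simpa using h
  -- the radial polynomial and Markov on `[-1,1]`
  set k : ℝ[X] := ∑ S : Finset (Fin N), C (a S * ∏ j ∈ S, Z j) * X ^ S.card with hk
  have hkdeg : k.degree ≤ d := Polynomial.degree_le_of_natDegree_le (natDegree_radPoly_le ha Z)
  have hkM : ∀ ρ ∈ Set.Icc (-1 : ℝ) 1, |k.eval ρ| ≤ 1 := by
    intro ρ hρ
    rw [hk, eval_radPoly]
    refine abs_mlext_le_one hb fun i => ?_
    rw [abs_mul]
    have := abs_le.mpr hρ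
    calc |ρ| * |Z i| ≤ 1 * 1 := mul_le_mul (abs_le.mpr hρ) (hsgn (z i)) (abs_nonneg _) zero_le_one
      _ = 1 := one_mul 1
  have hk' : |(derivative k).eval 1| ≤ (d : ℝ) ^ 2 := by
    have h := Literature.Analysis.Approximation.markov_inequality hkdeg hkM (x := 1)
      ⟨by norm_num, le_refl _⟩
    simpa using h
  -- assemble
  have hid : ∑ S : Finset (Fin N), a S * ∑ i ∈ S, sgn (y i) * ∏ j ∈ S.erase i, sgn (z j) =
      (derivative g).eval 0 + (derivative k).eval 1 := by
    rw [hg, hk, eval_zero_derivative_dirPoly, eval_one_derivative_radPoly]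
    exact dec_eq_dir_add_rad a Y Z
  rw [hid]
  calc |(derivative g).eval 0 + (derivative k).eval 1|
      ≤ |(derivative g).eval 0| + |(derivative k).eval 1| := abs_add_le _ _
    _ ≤ 2 * (d : ℝ) ^ 2 + (d : ℝ) ^ 2 := add_le_add hg' hk'
    _ = 3 * (d : ℝ) ^ 2 := by ring

end StubSupBound

open StubSupBound in
/-- **Stub `stub_supBound` of line `odonnell-zhao`** (registered signature, BY NAME; O'Donnell–Zhao Cor. 2.12 in
the hypercube case): the one-block-decoupled function of a `[0,1]`-bounded polynomial of total degree `≤ d` is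
bounded by `K d^κ` on the cube — here with `(κ, K) = (2, 3)`, by Markov's inequality applied to the directional and
radial restrictions of the multilinear extension (instead of the paper's Vandermonde interpolation, Lemma 4.1).
[cite: ODonnellZhao2016, Cor. 2.12] [cite: Korneichuk1991, Thm. 3.5.8] -/
theorem stub_supBound :
    ∃ (κ : ℕ) (K : ℝ), 0 < K ∧ ∀ (N d : ℕ) (p : MvPolynomial (Fin N) ℝ), 1 ≤ d → p.totalDegree ≤ d →
      (∀ x, 0 ≤ evalBool p x ∧ evalBool p x ≤ 1) → ∀ (y z : Fin N → Bool),
        |∑ S : Finset (Fin N), cubeFourierCoeff (evalBool p) S *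
            ∑ i ∈ S, sgn (y i) * ∏ j ∈ S.erase i, sgn (z j)| ≤ K * (d : ℝ) ^ κ :=
  ⟨2, 3, by norm_num, fun _ _ _ _ hdeg hb y z => abs_dec_le hdeg hb y z⟩

end Summit.QuantumAdvantage.QuantumAdvantage.Cruxes.OneBlockDecoupling.OdonnellZhao

end
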